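import Summits.QuantumFields.BalabanUV.T4Continuum.Support.NE7K1LinTwoRunUpper
import Summits.QuantumFields.BalabanUV.T4Continuum.Support.NE7K1LinTwoRunBonds

/-!
# NE7K1LinTwoRunLower — row NE7 (node U5), candidate route HOM, path H1L, cell K1-lin(s): TWO-RUN COMPARISON AT
# `A = 0`, LOWER HALF — `c₁·⟨V, P_A V⟩ ≤ ⟨V, P_B^{Schur}V⟩` with `c₁ = (3((d+1)L² + 1)·L^{d−1})⁻¹` explicit and mesh-free

Lineage `b2b-balaban-t4-ne7-p2` (CRUX PROVER NE7 #2), generation 64; companion of `NE7K1LinTwoRunUpper` (`⟨V,P_B^{Schur}V⟩ ≤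
L²⟨V,P_A V⟩`).  WHY.  `NE7K1LinSchurLineDerivRel.inv_line_sub_inv_line_sq_le` (the η-uniform `∂_s` letter) needs BOTH halves of
the two-run comparability; the lower half is the substantive one (at `s = 1` the propagator is `(P_B^{Schur})⁻¹` and
`∂_sG(1) ∋ G(1)P_AG(1)` is bounded iff `P_A ≲ P_B^{Schur}`).  THIS FILE: **`runA_form_le_schurB`** — for `a > 0`, `n ≥ 1`, `R′` a
union of `nL`-blocks and every `V` on run A's lattice, `c₁·⟨V, runA V⟩ ≤ ⟨V, twoCutoffLine … 1 V⟩` with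
`c₁ = ((6(d+1)L² + 6)·L^{d+1}∕(2L²))⁻¹ = (3((d+1)L² + 1)L^{d−1})⁻¹`.  Route: the Schur form is ATTAINED at the optimal
fluctuation (`NE7K1LinTwoRunKit.schur_form_eq_min`), whose fine field `φ = T(V,ψ_*)` has block sums `L^{d+1}V_b`
(`blockSum_coordT`); its averaging part EQUALS run A's (`avgPart_eq`); its Dirichlet part is `≥ (L^{d+1})⁻¹(nL)²·E`
(`NE7K1LinTwoRunBonds.bondEnergy_le_dirichletPart`) while run A's is `≤ (n²∕2)(6(d+1)L² + 6)·E`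
(`NE7K1LinTwoRunBonds.coarseDirichlet_le`).  The natural constant is `½` ((d+1)-dimensional Jensen); the crude route here trades
it for a short proof — every constant depends on `d, L` only, none on the mesh `n` or on `a`.

TOGETHER (`NE7K1LinTwoRunUpper` + this file + `NE7K1LinSchurLineDerivRel`): at `A = 0` the interpolated two-cutoff propagator
`G(s) = (twoCutoffLine s)⁻¹` is LIPSCHITZ IN `s` in operator norm with a mesh-free constant — the `∂_s` letter of cell
K1-lin(s) in the η-uniform currency (assembled in `NE7K1LinSchurLineDerivU1`).

HONEST FRAMING: Gaussian `A = 0`, finite regions, [folklore]; nothing printed asserted; no `sorry`.  FIXED FINITE T⁴, rung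
(B)+1; NE7 NOT PRINTED ∕ NOT PROVED; spine 0∕9; NOT infinite volume, NOT mass gap, NOT Clay.  HONEST DEPENDENCY: continuum YM on T⁴
⇐ BetaPertH ∧ nine spine estimates (0/9 proved); BetaPertH ⇐ (D1) ∧ (D4) ∧ CAP+tail; G-an2-4 gates asym, D1 and NE2/3/4.
-/

noncomputable section

open Finset Matrix

namespace Summit.QuantumFields.BalabanUV.T4Continuum.NE7K1LinTwoRunLower

open Literature.MathematicalPhysics.QuantumFieldTheory.Balaban1983to89
open Literature.MathematicalPhysics.QuantumFieldTheory.Balaban1983to89.B4Reflection242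
open Literature.MathematicalPhysics.QuantumFieldTheory.Balaban1983to89.B4BoxCov237
open Literature.MathematicalPhysics.QuantumFieldTheory.Balaban1983to89.B4Lower18
open Literature.MathematicalPhysics.QuantumFieldTheory.Balaban1983to89.B4Thm110ZeroBox (blk_blk)
open NE7K1LinSchurLineForm NE7K1LinSchurLineCoords NE7K1LinBlockCoords NE7K1LinSchurLineU1 NE7K1LinTwoRunKit
  NE7K1LinTwoRunUpper NE7K1LinTwoRunBonds

variable {d : ℕ}

/-! ### §3 The lower comparison -/

section Lower

variable {n L : ℕ} [NeZero L] {R' : Finset (Fin (d + 1) → ℤ)}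

/-- the explicit lower constant `c₁ = ((6(d+1)L² + 6)L^{d+1}∕(2L²))⁻¹` is positive. [folklore] -/
theorem lowerConst_pos (d L : ℕ) [NeZero L] :
    0 < ((6 * ((d : ℝ) + 1) * (L : ℝ) ^ 2 + 6) * (L : ℝ) ^ (d + 1) / (2 * (L : ℝ) ^ 2))⁻¹ := by
  have hLpos : (0 : ℝ) < L := by exact_mod_cast (NeZero.one_le : 1 ≤ L)
  positivity

/-- … and at most `1`. [folklore] -/
theorem lowerConst_le_one (d L : ℕ) [NeZero L] :
    ((6 * ((d : ℝ) + 1) * (L : ℝ) ^ 2 + 6) * (L : ℝ) ^ (d + 1) / (2 * (L : ℝ) ^ 2))⁻¹ ≤ 1 := by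
  have hL : 1 ≤ L := NeZero.one_le
  have hLpos : (0 : ℝ) < L := by exact_mod_cast hL
  refine inv_le_one_of_one_le₀ ?_
  rw [one_le_div (by positivity)]
  have hLp1 : (1 : ℝ) ≤ (L : ℝ) ^ (d + 1) := one_le_pow₀ (by exact_mod_cast hL)
  have hKpos : (0 : ℝ) ≤ 6 * ((d : ℝ) + 1) * (L : ℝ) ^ 2 + 6 := by positivity
  nlinarith [mul_le_mul_of_nonneg_left hLp1 hKpos, sq_nonneg (L : ℝ), mul_nonneg (Nat.cast_nonneg d) (sq_nonneg (L : ℝ))]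

/-- **TWO-RUN COMPARISON AT `A = 0`, LOWER HALF**: with `c₁ = (3((d+1)L² + 1)·L^{d−1}… )⁻¹` — precisely
`c₁ := ((6(d+1)L² + 6)·L^{d+1}∕(2L²))⁻¹ = (3((d+1)L²+1)L^{d−1})⁻¹` — `c₁·⟨V, P_A V⟩ ≤ ⟨V, P_B^{Schur}V⟩` for every `V`
(`a > 0`, `n ≥ 1`, `R′` a union of `nL`-blocks); mesh-free. [folklore] -/
theorem runA_form_le_schurB (hn : 1 ≤ n) (hR' : IsBlockUnion (n * L) R') {a : ℝ} (ha : 0 < a)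
    (V : ↥(R'.image (blk L)) → ℝ) :
    ((6 * ((d : ℝ) + 1) * (L : ℝ) ^ 2 + 6) * (L : ℝ) ^ (d + 1) / (2 * (L : ℝ) ^ 2))⁻¹ *
        (V ⬝ᵥ (runA n L a R').mulVec V) ≤
      V ⬝ᵥ (twoCutoffLine (isBlockUnion_fine hR') n a 1).mulVec V := by
  classical
  have hL : 1 ≤ L := NeZero.one_le
  have hR'L : IsBlockUnion L R' := isBlockUnion_fine hR'
  have hRc : IsBlockUnion n (R'.image (blk L)) := isBlockUnion_coarse hL hR'
  have hnL : 1 ≤ n * L := Nat.one_le_iff_ne_zero.2 (Nat.mul_ne_zero (Nat.one_le_iff_ne_zero.1 hn) (NeZero.ne L))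
  have hL0 : (L : ℝ) ≠ 0 := by exact_mod_cast (NeZero.ne L)
  have hLpos : (0 : ℝ) < L := by exact_mod_cast hL
  have hLpow : (0 : ℝ) < (L : ℝ) ^ (d + 1) := pow_pos hLpos _
  have hmin : 0 < min 2 a := lt_min (by norm_num) ha
  -- the Schur form is attained at the optimal fluctuation
  set H := runB hR'L n a with hH
  have hsymm : H.IsSymm := runB_isSymm hR'L n a
  have hblocks := (Matrix.isSymm_fromBlocks_iff.1 (by rw [fromBlocks_toBlocks H]; exact hsymm))
  have hH₁' : ∀ u, min 2 a / (L : ℝ) ^ (d + 1) * (u ⬝ᵥ u) ≤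
      u ⬝ᵥ (fromBlocks H.toBlocks₁₁ H.toBlocks₁₂ H.toBlocks₂₁ H.toBlocks₂₂).mulVec u := by
    intro u
    rw [fromBlocks_toBlocks]
    have h := coercive_congr (coordT hR'L) (fineOpR (n * L) a 0 R') (c := ((L : ℝ) ^ (d + 1))⁻¹) (σM := min 2 a)
      (cT := 1) (by positivity) hmin.le (fun φ => lower18_zero hnL ha.le hR' φ) (dot_le_coordT hR'L) u
    have hσ' : ((L : ℝ) ^ (d + 1))⁻¹ * min 2 a * 1 = min 2 a / (L : ℝ) ^ (d + 1) := by field_simp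
    rw [hσ'] at h
    exact h
  have hDu : IsUnit (H.toBlocks₂₂).det := isUnit_det_fineR _ _ _ _ (div_pos hmin hLpow) hH₁'
  set ψ : ↥(R'.image (blk L)) × NZ d L → ℝ := -((H.toBlocks₂₂)⁻¹.mulVec ((H.toBlocks₂₁).mulVec V)) with hψ
  have hmin_eq : V ⬝ᵥ (twoCutoffLine hR'L n a 1).mulVec V = Sum.elim V ψ ⬝ᵥ H.mulVec (Sum.elim V ψ) := by
    have h := schur_form_eq_min H.toBlocks₁₁ H.toBlocks₁₂ H.toBlocks₂₁ H.toBlocks₂₂ hblocks.2.1 hblocks.2.2.2 hDu V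
    rw [fromBlocks_toBlocks] at h
    rw [twoCutoffLine_one, h]
  -- the optimal fine field and its block sums
  set φ : ↥R' → ℝ := (coordT hR'L).mulVec (Sum.elim V ψ) with hφdef
  have hφ : ∀ b, ∑ x' ∈ Finset.univ.filter (fun x' => rblk L R' x' = b), φ x' = (L : ℝ) ^ (d + 1) * V b :=
    fun b => blockSum_coordT hR'L (Sum.elim V ψ) b
  have hform : Sum.elim V ψ ⬝ᵥ H.mulVec (Sum.elim V ψ) = ((L : ℝ) ^ (d + 1))⁻¹ * (φ ⬝ᵥ (fineOpR (n * L) a 0 R').mulVec φ) := by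
    rw [hH, runB, dot_congr_mulVec]
  -- run A's form and run B's form in Dirichlet + averaging parts
  rw [show twoCutoffLine (isBlockUnion_fine hR') n a 1 = twoCutoffLine hR'L n a 1 from rfl, hmin_eq, hform,
    fineOpR_form hnL hR' a 0 φ, runA, fineOpR_form hn hRc a 0 V, zero_mul, add_zero, zero_mul, add_zero]
  have havg_eq := avgPart_eq hn a φ V hφ
  -- abbreviations
  set Etot := ∑ k : RBond R', (φ (rtgt k) - φ (rsrc k)) ^ 2 with hEtot
  set COARSE := ∑ x : ↥(R'.image (blk L)), ∑ y : ↥(R'.image (blk L)),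
    (if y.1 ∈ nbrs x.1 then (V x - V y) ^ 2 else 0) with hCOARSE
  set FINE := ∑ x : ↥R', ∑ y : ↥R', (if y.1 ∈ nbrs x.1 then (φ x - φ y) ^ 2 else 0) with hFINE
  set AVG := a * ((n : ℝ) ^ (d + 1))⁻¹ * ∑ B₀ : ↥((R'.image (blk L)).image (blk n)),
    (∑ b ∈ Finset.univ.filter (fun b => rblk n (R'.image (blk L)) b = B₀), V b) ^ 2 with hAVG
  have hAVG_nn : 0 ≤ AVG := by
    have : 0 ≤ ∑ B₀ : ↥((R'.image (blk L)).image (blk n)),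
        (∑ b ∈ Finset.univ.filter (fun b => rblk n (R'.image (blk L)) b = B₀), V b) ^ 2 :=
      Finset.sum_nonneg fun _ _ => sq_nonneg _
    positivity
  have hCOARSE_nn : 0 ≤ COARSE :=
    Finset.sum_nonneg fun _ _ => Finset.sum_nonneg fun _ _ => by split_ifs <;> positivity
  have hEtot_nn : 0 ≤ Etot := Finset.sum_nonneg fun _ _ => sq_nonneg _
  -- (i) coarse Dirichlet ≤ K·Etot, (ii) (nL)²·Etot ≤ fine Dirichlet part
  have hcoarse : COARSE ≤ (6 * ((d : ℝ) + 1) * (L : ℝ) ^ 2 + 6) * Etot := coarseDirichlet_le hR'L φ V hφ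
  have hfine : (((n * L : ℕ) : ℝ)) ^ 2 * Etot ≤ ((n * L : ℕ) : ℝ) ^ 2 / 2 * FINE := bondEnergy_le_dirichletPart (n * L) R' φ
  -- the constant
  set K : ℝ := 6 * ((d : ℝ) + 1) * (L : ℝ) ^ 2 + 6 with hK
  have hKpos : 0 < K := by positivity
  set c₁ : ℝ := (K * (L : ℝ) ^ (d + 1) / (2 * (L : ℝ) ^ 2))⁻¹ with hc₁
  have hc₁pos : 0 < c₁ := lowerConst_pos d L
  have hc₁le : c₁ ≤ 1 := lowerConst_le_one d L
  -- Dirichlet comparison: c₁·(n²/2)·COARSE ≤ L^{−(d+1)}·((nL)²/2)·FINE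
  have hdir : c₁ * ((n : ℝ) ^ 2 / 2 * COARSE) ≤ ((L : ℝ) ^ (d + 1))⁻¹ * (((n * L : ℕ) : ℝ) ^ 2 / 2 * FINE) := by
    have h1 : c₁ * ((n : ℝ) ^ 2 / 2 * COARSE) ≤ c₁ * ((n : ℝ) ^ 2 / 2 * (K * Etot)) :=
      mul_le_mul_of_nonneg_left (mul_le_mul_of_nonneg_left hcoarse (by positivity)) hc₁pos.le
    have h2 : ((L : ℝ) ^ (d + 1))⁻¹ * ((((n * L : ℕ) : ℝ)) ^ 2 * Etot) ≤
        ((L : ℝ) ^ (d + 1))⁻¹ * (((n * L : ℕ) : ℝ) ^ 2 / 2 * FINE) :=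
      mul_le_mul_of_nonneg_left hfine (by positivity)
    have e : c₁ * ((n : ℝ) ^ 2 / 2 * (K * Etot)) = ((L : ℝ) ^ (d + 1))⁻¹ * ((((n * L : ℕ) : ℝ)) ^ 2 * Etot) := by
      rw [hc₁]
      push_cast
      field_simp
    linarith [h1, h2, e.le, e.ge]
  have havg : c₁ * AVG ≤ AVG := by nlinarith
  linarith [hdir, havg, havg_eq]

end Lower

end Summit.QuantumFields.BalabanUV.T4Continuum.NE7K1LinTwoRunLower
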